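import Literature.Combinatorics.LorentzianPolynomials.Substitution
import HarnessLib

/-!
# M-convex sets under maps of the index set: splitting (pull-back), aggregation (push-forward along an
# ARBITRARY map) and the union of lower shifts (Brändén–Huh 2020, Lemma 2.8 / proof of Thm. 2.10, after
# Kobayashi–Murota–Tanaka; the supports of `f(w_{ψ(e)})_e`, of `f(v_{φ(e)})` and of `Σ_{i∈S} a_i ∂_i f`)

Layer `Literature/Combinatorics/LorentzianPolynomials`, namespace `Literature.Combinatorics.LorentzianPolynomials`;
lane `lit-hodgefound` (Track 2 foundations library), seat p16, generation 28 (row g28-#2). Theorems only (no definition,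
no named fact; net debt 0). These are the three support statements needed by the seat's formalization of Brändén–Huh's
Theorem 2.10 (`f(Av) ∈ L^d_m` for nonnegative `A`) and Corollary 2.11 (`Σ a_i ∂_i f ∈ L^{d-1}_n`) on the tree's
Definition-2.6 `lorentzian`: by `mem_lorentzian_iff_forall_sigPos_hessian` only the TOP-LEVEL support has to be shown
M-convex, and the supports in question are images / preimages of `supp f` under `Finsupp.mapDomain`.

## Source (verbatim) — [BrandenHuh2019] P. Brändén, J. Huh, *Lorentzian polynomials*, Ann. of Math. 192 (2020),
## arXiv:1902.03719 (held `paper:arxiv-1902.03719`), §2.2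

Lemma 2.8 ("If `f ∈ M^d_n`, then `(1 + θ w_i ∂_j) f ∈ M^d_n`"), proof: "We use two combinatorial lemmas from [KMT07].
Introduce a new variable `w_{n+1}`, and set `g(w_1, …, w_n, w_{n+1}) = f(w_1, …, w_n + w_{n+1})` […] By [KMT07, Lemma 9],
the support of `g` is M-convex. In terms of [Mur03, Section 6.3], the support of `g` is obtained from the support of `f`
by an elementary splitting, and the operation of splitting preserves M-convexity [Mur03, Theorem 6.15 (4)]. […] Since
the intersection of an M-convex set with a cartesian product of intervals is M-convex, […] By [KMT07, Lemma 10], the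
above displayed inclusion implies `(1 + w_i ∂_n) f ∈ M^d_n`. In terms of [KMT07], the support of `(1 + w_i ∂_n) f` is
obtained from the support of `(1 + w_{n+1} ∂_n) f` by an elementary aggregation, and the operation of aggregation
preserves M-convexity." Proof of Thm. 2.10: "As observed in the proof of Lemma 2.8, an elementary splitting preserves
M-convexity: `f(w_1, …, w_{n-1}, w_n + w_{n+1}) ∈ M^d_{n+1}`. […] an elementary aggregation preserves M-convexity, and
hence `f(w_1, …, w_{n-1}, w_{n-1} + w_n) ∈ M^d_n`." Corollary 2.11: "If `f ∈ L^d_n`, then `Σ_{i=1}^n a_i ∂_i f ∈ L^{d-1}_n`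
for any `a_1, …, a_n ≥ 0`."
[KMT07] = Y. Kobayashi, K. Murota, K. Tanaka, *Operations on M-convex functions on jump systems*, SIAM J. Discrete Math.
21 (2007); [Mur03] = K. Murota, *Discrete convex analysis*, SIAM 2003, §6.3, Thm. 6.15.

## What is proved (for the one-sided exchange property `IsMConvex` of `Basic.lean`; all maps of index types ARBITRARY)

* §1 `mapDomain_apply_eq_sum` (`(ψ_* ζ)_i = Σ_{ψ e = i} ζ_e`) and the two counting facts `exists_lt_of_mapDomain_lt`,
  `exists_lt_of_lt_of_mapDomain_le`.
* §2 **`IsMConvex.preimage_mapDomain`** — SPLITTING, in the general form "pull back along any `ψ : E → σ`": if `J ⊆ ℕ^σ`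
  is M-convex then so is `{ζ ∈ ℕ^E | ψ_* ζ ∈ J}` (each coordinate `i` split into the coordinates `ψ⁻¹(i)`; Brändén–Huh's
  elementary splitting is `E = [n+1]`, `ψ(n+1) = n`). Direct from the exchange axiom.
* §3 **`IsMConvex.image_mapDomain_of_any`** — AGGREGATION, in the general form "push forward along any `φ : E → τ`":
  if `J ⊆ ℕ^E` is M-convex then so is `φ_* J = {φ_* ζ | ζ ∈ J}` (Brändén–Huh's elementary aggregation is `φ(n+1) = n`;
  the tree's `IsMConvex.image_mapDomain` was the injective case). Proof by induction on the overlap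
  `Σ_e min(ξ_e, ζ'_e)` of representatives: an exchange step in `J` either lands in a fibre where the target inequality
  holds, or raises the overlap (`exists_exchange_of_overlap_le`).
* §4 **`IsMConvex.lowerShifts`** — the support of `Σ_{i ∈ S} a_i ∂_i f`, `a_i > 0`: if `J` is M-convex then so is
  `{x | ∃ i ∈ S, x + e_i ∈ J}` (for `S = {i}` this is `Basic`'s `IsMConvex.shift`). Direct from the exchange axiom
  (two exchange steps).
-/

noncomputable section

open Finsupp Finset

namespace Literature.Combinatorics.LorentzianPolynomials

variable {σ τ E : Type*}

/-! ## §1 Coordinates of a push-forward `ψ_* ζ = Finsupp.mapDomain ψ ζ` -/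

section MapDomain

variable [Fintype E] [DecidableEq σ]

/-- `(ψ_* ζ)_i = Σ_{e : ψ(e) = i} ζ_e` — the exponent of `w_i` in the image of the monomial `Π_e X_e^{ζ_e}` under
`X_e ↦ w_{ψ(e)}`. [cite: BrandenHuh2019, §2.2 proof of Lemma 2.8 ("elementary aggregation")] -/
theorem mapDomain_apply_eq_sum (ψ : E → σ) (ζ : E →₀ ℕ) (i : σ) :
    Finsupp.mapDomain ψ ζ i = ∑ e ∈ univ.filter (fun e ↦ ψ e = i), ζ e := by
  rw [Finsupp.mapDomain, Finsupp.sum_fintype _ _ (fun e ↦ Finsupp.single_zero _), Finsupp.finsetSum_apply,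
    Finset.sum_filter]
  exact Finset.sum_congr rfl fun e _ ↦ by rw [Finsupp.single_apply]

/-- If `(ψ_* ζ')_i < (ψ_* ζ)_i` then `ζ'_e < ζ_e` for some `e` over `i`. [cite: BrandenHuh2019, §2.2 proof of Lemma 2.8] -/
theorem exists_lt_of_mapDomain_lt (ψ : E → σ) {ζ ζ' : E →₀ ℕ} {i : σ}
    (h : Finsupp.mapDomain ψ ζ' i < Finsupp.mapDomain ψ ζ i) : ∃ e, ψ e = i ∧ ζ' e < ζ e := by
  rw [mapDomain_apply_eq_sum, mapDomain_apply_eq_sum] at h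
  obtain ⟨e, he, hlt⟩ := Finset.exists_lt_of_sum_lt h
  exact ⟨e, (Finset.mem_filter.1 he).2, hlt⟩

/-- If `ζ'_e < ζ_e` but `(ψ_* ζ)_{ψ e} ≤ (ψ_* ζ')_{ψ e}`, then `ζ_{e'} < ζ'_{e'}` for another `e'` over `ψ(e)`.
[cite: BrandenHuh2019, §2.2 proof of Lemma 2.8] -/
theorem exists_lt_of_lt_of_mapDomain_le [DecidableEq E] (ψ : E → σ) {ζ ζ' : E →₀ ℕ} {e : E} (he : ζ' e < ζ e)
    (h : Finsupp.mapDomain ψ ζ (ψ e) ≤ Finsupp.mapDomain ψ ζ' (ψ e)) : ∃ e', ψ e' = ψ e ∧ e' ≠ e ∧ ζ e' < ζ' e' := by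
  rw [mapDomain_apply_eq_sum, mapDomain_apply_eq_sum] at h
  have hmem : e ∈ univ.filter (fun e' ↦ ψ e' = ψ e) := Finset.mem_filter.2 ⟨Finset.mem_univ _, rfl⟩
  rw [← Finset.add_sum_erase _ _ hmem, ← Finset.add_sum_erase _ _ hmem] at h
  have h' : ∑ x ∈ (univ.filter (fun e' ↦ ψ e' = ψ e)).erase e, ζ x <
      ∑ x ∈ (univ.filter (fun e' ↦ ψ e' = ψ e)).erase e, ζ' x := by omega
  obtain ⟨e', he', hlt⟩ := Finset.exists_lt_of_sum_lt h'
  exact ⟨e', (Finset.mem_filter.1 (Finset.mem_of_mem_erase he')).2, Finset.ne_of_mem_erase he', hlt⟩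

end MapDomain

/-! ## §2 Splitting: the pull-back of an M-convex set along any map of index sets is M-convex -/

section Splitting

/-- **Splitting preserves M-convexity** ([KMT07, Lemma 9] / [Mur03, Thm. 6.15 (4)] as used by Brändén–Huh), general
form: for ANY map `ψ : E → σ` and any M-convex `J ⊆ ℕ^σ`, the pull-back `{ζ ∈ ℕ^E | ψ_* ζ ∈ J}` is M-convex — the support
of `f(X_e ↦ w_{ψ(e)})`, i.e. of `f` with each `w_i` replaced by `Σ_{e ∈ ψ⁻¹(i)} X_e` (Brändén–Huh's elementary splitting
`f(w_1, …, w_n + w_{n+1})` is `E = [n+1] → [n]`, `n+1 ↦ n`). Proof: for `ζ, ζ'` in the pull-back and `ζ'_e < ζ_e`, either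
`(ψ_*ζ)_{ψ e} > (ψ_*ζ')_{ψ e}` and an exchange step `ψ_*ζ - e_{ψ e} + e_j ∈ J` lifts to `ζ - e_e + e_{e'}` for any `e'` over
`j` with `ζ_{e'} < ζ'_{e'}`, or the fibre of `ψ(e)` itself contains such an `e'` and `ζ - e_e + e_{e'}` has the same image.
[cite: BrandenHuh2019, §2.2 Lemma 2.8 (proof, "the operation of splitting preserves M-convexity") and proof of Thm. 2.10
(I)] -/
theorem IsMConvex.preimage_mapDomain [Fintype E] {J : Set (σ →₀ ℕ)} (hJ : IsMConvex J) (ψ : E → σ) :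
    IsMConvex {ζ : E →₀ ℕ | Finsupp.mapDomain ψ ζ ∈ J} := by
  classical
  intro ζ ζ' hζ hζ' e he
  simp only [Set.mem_setOf_eq] at hζ hζ' ⊢
  have hζe : ζ e ≠ 0 := by omega
  by_cases hlt : Finsupp.mapDomain ψ ζ' (ψ e) < Finsupp.mapDomain ψ ζ (ψ e)
  · -- exchange downstairs, lift the partner
    obtain ⟨j, hj, hmem⟩ := hJ hζ hζ' (ψ e) hlt
    obtain ⟨e', he', hlt'⟩ := exists_lt_of_mapDomain_lt ψ hj
    refine ⟨e', hlt', ?_⟩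
    rwa [mapDomain_sub_single_add_single ψ hζe e', he']
  · -- the fibre of `ψ e` already contains the partner
    push Not at hlt
    obtain ⟨e', he', -, hlt'⟩ := exists_lt_of_lt_of_mapDomain_le ψ he hlt
    refine ⟨e', hlt', ?_⟩
    have hi : Finsupp.mapDomain ψ ζ (ψ e) ≠ 0 := by
      rw [mapDomain_apply_eq_sum]
      refine Nat.pos_iff_ne_zero.1 (Nat.lt_of_lt_of_le (Nat.pos_iff_ne_zero.2 hζe) ?_)
      exact Finset.single_le_sum (f := fun x ↦ ζ x) (fun _ _ ↦ Nat.zero_le _)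
        (Finset.mem_filter.2 ⟨Finset.mem_univ _, rfl⟩)
    rwa [mapDomain_sub_single_add_single ψ hζe e', he', Finsupp.sub_add_single_one_cancel hi]

end Splitting

/-! ## §3 Aggregation: the push-forward of an M-convex set along any map of index sets is M-convex -/

section Aggregation

variable [Fintype E]

/-- The overlap `Σ_e min(ξ_e, ζ'_e)` of two exponent vectors — the potential that an exchange step towards `ζ'` raises
by one — is at most `|ζ'|`. [folklore] -/
private theorem overlap_le (ξ ζ' : E →₀ ℕ) : ∑ e, min (ξ e) (ζ' e) ≤ ∑ e, ζ' e :=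
  Finset.sum_le_sum fun _ _ ↦ min_le_right _ _

/-- An exchange step `ξ ↦ ξ - e_a + e_b` with `ξ_a > ζ'_a` and `ξ_b < ζ'_b` raises the overlap with `ζ'` by one. [folklore] -/
private theorem overlap_exchange [DecidableEq E] {ξ ζ' : E →₀ ℕ} {a b : E} (ha : ζ' a < ξ a) (hb : ξ b < ζ' b) :
    ∑ e, min ((ξ - Finsupp.single a 1 + Finsupp.single b 1 : E →₀ ℕ) e) (ζ' e) = (∑ e, min (ξ e) (ζ' e)) + 1 := by
  have hab : a ≠ b := by rintro rfl; omega
  have hpt : ∀ x, min ((ξ - Finsupp.single a 1 + Finsupp.single b 1 : E →₀ ℕ) x) (ζ' x) =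
      min (ξ x) (ζ' x) + if x = b then 1 else 0 := by
    intro x
    rw [Finsupp.add_apply, Finsupp.tsub_apply]
    rcases eq_or_ne x a with hxa | hxa
    · rw [hxa, Finsupp.single_eq_same, Finsupp.single_eq_of_ne hab, if_neg hab]
      omega
    · rw [Finsupp.single_eq_of_ne hxa]
      rcases eq_or_ne x b with hxb | hxb
      · rw [hxb, Finsupp.single_eq_same, if_pos rfl]
        omega
      · rw [Finsupp.single_eq_of_ne hxb, if_neg hxb]
        omega
  simp_rw [hpt, Finset.sum_add_distrib, Finset.sum_ite_eq' Finset.univ b, if_pos (Finset.mem_univ b)]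

/-- `φ_* (ξ - e_a + e_b) + e_{φ a} = φ_* ξ + e_{φ b}` when `ξ_a ≠ 0`. [cite: BrandenHuh2019, §2.2 proof of Lemma 2.8] -/
private theorem mapDomain_exchange_add (φ : E → τ) {ξ : E →₀ ℕ} {a : E} (ha : ξ a ≠ 0) (b : E) :
    Finsupp.mapDomain φ (ξ - Finsupp.single a 1 + Finsupp.single b 1) + Finsupp.single (φ a) 1 =
      Finsupp.mapDomain φ ξ + Finsupp.single (φ b) 1 := by
  classical
  rw [mapDomain_sub_single_add_single φ ha b, add_right_comm, Finsupp.sub_add_single_one_cancel]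
  rw [mapDomain_apply_eq_sum]
  refine Nat.pos_iff_ne_zero.1 (Nat.lt_of_lt_of_le (Nat.pos_iff_ne_zero.2 ha) ?_)
  exact Finset.single_le_sum (f := fun x ↦ ξ x) (fun _ _ ↦ Nat.zero_le _)
    (Finset.mem_filter.2 ⟨Finset.mem_univ _, rfl⟩)

/-- The engine of the aggregation lemma. Fix `ζ' ∈ J`, a target `γ ∈ ℕ^τ` and an index `k` with `(φ_*ζ')_k < γ_k`. If some
`ξ ∈ J` has `φ_*ξ + e_k = γ + e_{k''}` (i.e. `φ_*ξ = γ - e_k + e_{k''}`), then there are `k'` with `γ_{k'} < (φ_*ζ')_{k'}` and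
`ξ* ∈ J` with `φ_*ξ* + e_k = γ + e_{k'}`: either `k''` already qualifies, or `(φ_*ξ)_{k''} > (φ_*ζ')_{k''}` gives an `e`
over `k''` with `ξ_e > ζ'_e`, and an exchange step `ξ - e_e + e_{e₁}`, `ξ_{e₁} < ζ'_{e₁}`, in `J` replaces `k''` by
`φ(e₁)` while raising the overlap with `ζ'` — induction on `|ζ'| - overlap`. [cite: BrandenHuh2019, §2.2 proof of Lemma
2.8 ("the operation of aggregation preserves M-convexity", after [KMT07, Lemma 10])] -/
private theorem exists_exchange_of_overlap_le [DecidableEq E] [DecidableEq τ] {J : Set (E →₀ ℕ)} (hJ : IsMConvex J)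
    (φ : E → τ) {ζ' : E →₀ ℕ} (hζ' : ζ' ∈ J) (γ : τ →₀ ℕ) (k : τ) (hk : Finsupp.mapDomain φ ζ' k < γ k) :
    ∀ (n : ℕ) {ξ : E →₀ ℕ}, ξ ∈ J → (∑ e, ζ' e) - (∑ e, min (ξ e) (ζ' e)) ≤ n → ∀ {k'' : τ},
      Finsupp.mapDomain φ ξ + Finsupp.single k 1 = γ + Finsupp.single k'' 1 →
      ∃ k', γ k' < Finsupp.mapDomain φ ζ' k' ∧
        ∃ ξ' ∈ J, Finsupp.mapDomain φ ξ' + Finsupp.single k 1 = γ + Finsupp.single k' 1 := by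
  intro n
  induction n with
  | zero =>
    intro ξ hξ hn k'' hγ
    by_cases hdone : γ k'' < Finsupp.mapDomain φ ζ' k''
    · exact ⟨k'', hdone, ξ, hξ, hγ⟩
    · exfalso
      -- an exchange step would raise the overlap beyond `|ζ'|`
      push Not at hdone
      have hlt : Finsupp.mapDomain φ ζ' k'' < Finsupp.mapDomain φ ξ k'' := by
        have h := congrArg (fun δ : τ →₀ ℕ ↦ δ k'') hγ
        rw [Finsupp.add_apply, Finsupp.add_apply, Finsupp.single_apply, Finsupp.single_eq_same] at h
        by_cases hkk : k = k''
        · rw [if_pos hkk] at h; subst hkk; omega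
        · rw [if_neg hkk] at h; omega
      obtain ⟨e, he, hlt'⟩ := exists_lt_of_mapDomain_lt φ hlt
      obtain ⟨e₁, he₁, -⟩ := hJ hξ hζ' e hlt'
      have h1 := overlap_exchange (ξ := ξ) (ζ' := ζ') hlt' he₁
      have h2 := overlap_le (ξ - Finsupp.single e 1 + Finsupp.single e₁ 1) ζ'
      omega
  | succ n ih =>
    intro ξ hξ hn k'' hγ
    by_cases hdone : γ k'' < Finsupp.mapDomain φ ζ' k''
    · exact ⟨k'', hdone, ξ, hξ, hγ⟩
    · push Not at hdone
      have hlt : Finsupp.mapDomain φ ζ' k'' < Finsupp.mapDomain φ ξ k'' := by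
        have h := congrArg (fun δ : τ →₀ ℕ ↦ δ k'') hγ
        rw [Finsupp.add_apply, Finsupp.add_apply, Finsupp.single_apply, Finsupp.single_eq_same] at h
        by_cases hkk : k = k''
        · rw [if_pos hkk] at h; subst hkk; omega
        · rw [if_neg hkk] at h; omega
      obtain ⟨e, he, hlt'⟩ := exists_lt_of_mapDomain_lt φ hlt
      obtain ⟨e₁, he₁, hmem⟩ := hJ hξ hζ' e hlt'
      have h1 := overlap_exchange (ξ := ξ) (ζ' := ζ') hlt' he₁
      refine ih hmem (by omega) (k'' := φ e₁) ?_
      -- `φ_*(ξ - e_e + e_{e₁}) + e_k = γ + e_{φ e₁}`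
      have hξe : ξ e ≠ 0 := by omega
      have h3 := mapDomain_exchange_add φ hξe e₁
      rw [he] at h3
      have h4 : Finsupp.mapDomain φ (ξ - Finsupp.single e 1 + Finsupp.single e₁ 1) + Finsupp.single k 1 +
          Finsupp.single k'' 1 = γ + Finsupp.single (φ e₁) 1 + Finsupp.single k'' 1 :=
        calc Finsupp.mapDomain φ (ξ - Finsupp.single e 1 + Finsupp.single e₁ 1) + Finsupp.single k 1 +
              Finsupp.single k'' 1
            = Finsupp.mapDomain φ (ξ - Finsupp.single e 1 + Finsupp.single e₁ 1) + Finsupp.single k'' 1 +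
              Finsupp.single k 1 := add_right_comm _ _ _
          _ = Finsupp.mapDomain φ ξ + Finsupp.single k 1 + Finsupp.single (φ e₁) 1 := by rw [h3, add_right_comm]
          _ = γ + Finsupp.single (φ e₁) 1 + Finsupp.single k'' 1 := by rw [hγ, add_right_comm]
      exact add_right_cancel h4

/-- **Aggregation preserves M-convexity** ([KMT07, Lemma 10] / [Mur03, Thm. 6.15] as used by Brändén–Huh), general form:
for ANY map `φ : E → τ` and any M-convex `J ⊆ ℕ^E`, the push-forward `φ_* J = {φ_* ζ | ζ ∈ J} ⊆ ℕ^τ` is M-convex — the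
support of `f(X_e ↦ v_{φ(e)})` for `f` with nonnegative coefficients (Brändén–Huh's elementary aggregation / the
diagonalization `f(w_1, …, w_{n-1}, w_{n-1})` of Thm. 2.10 (III) is `φ(n) = n - 1`; the injective case is the tree's
`IsMConvex.image_mapDomain`). [cite: BrandenHuh2019, §2.2 Lemma 2.8 (proof, "the operation of aggregation preserves
M-convexity") and proof of Thm. 2.10 (III)] -/
theorem IsMConvex.image_mapDomain_of_any {J : Set (E →₀ ℕ)} (hJ : IsMConvex J) (φ : E → τ) :
    IsMConvex (Finsupp.mapDomain φ '' J) := by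
  classical
  rintro _ _ ⟨ζ, hζ, rfl⟩ ⟨ζ', hζ', rfl⟩ k hk
  obtain ⟨k', hk', ξ', hξ', hγ⟩ := exists_exchange_of_overlap_le hJ φ hζ' (Finsupp.mapDomain φ ζ) k hk
    ((∑ e, ζ' e) - ∑ e, min (ζ e) (ζ' e)) hζ le_rfl rfl
  refine ⟨k', hk', ξ', hξ', ?_⟩
  have hk0 : Finsupp.mapDomain φ ζ k ≠ 0 := by omega
  have h : Finsupp.mapDomain φ ξ' + Finsupp.single k 1 =
      Finsupp.mapDomain φ ζ - Finsupp.single k 1 + Finsupp.single k' 1 + Finsupp.single k 1 := by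
    rw [hγ, add_right_comm, Finsupp.sub_add_single_one_cancel hk0]
  exact add_right_cancel h

end Aggregation

/-! ## §4 The union of lower shifts: the support of `Σ_{i ∈ S} a_i ∂_i f` -/

section LowerShifts

/-- `x + e_m - e_p + e_r = x - e_p + e_r + e_m` when `x_p ≠ 0` (no truncation). [cite: BrandenHuh2019, §2.2 (p. 11,
"`α - e_i + e_j`")] -/
theorem exchange_add_right_comm {x : σ →₀ ℕ} {p : σ} (hp : x p ≠ 0) (r m : σ) :
    x + Finsupp.single m 1 - Finsupp.single p 1 + Finsupp.single r 1 =
      x - Finsupp.single p 1 + Finsupp.single r 1 + Finsupp.single m 1 := by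
  rw [← Finsupp.sub_single_one_add hp, add_right_comm]

/-- **The union of lower shifts of an M-convex set is M-convex**: for any M-convex `J ⊆ ℕ^σ` and any set of indices `S`,
`{x | x + e_i ∈ J for some i ∈ S}` is M-convex — the support of the nonnegative directional derivative
`Σ_{i ∈ S} a_i ∂_i f` (`a_i > 0`) of an `f ∈ M^d_n`, the support half of Brändén–Huh's Corollary 2.11 (`S = {i}`:
`Basic`'s `IsMConvex.shift`). Proof from the exchange axiom in two steps: for `x + e_i, y + e_k ∈ J` and `x_p > y_p`,
if `x + e_k ∈ J` one exchange at `p` suffices; otherwise an exchange at `p` produces `x - e_p + e_i + e_k ∈ J` (or an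
answer), and a second exchange at `i` produces an answer (the alternative `x + e_k ∈ J` being excluded).
[cite: BrandenHuh2019, §2.2 Cor. 2.11 ("`Σ_{i=1}^n a_i ∂_i f ∈ L^{d-1}_n`", whose membership in `M^{d-1}_n` this is) and
Lemma 2.8] -/
theorem IsMConvex.lowerShifts {J : Set (σ →₀ ℕ)} (hJ : IsMConvex J) (S : Set σ) :
    IsMConvex {x : σ →₀ ℕ | ∃ i ∈ S, x + Finsupp.single i 1 ∈ J} := by
  classical
  rintro x y ⟨i, hiS, hα⟩ ⟨k, hkS, hβ⟩ p hp
  simp only [Set.mem_setOf_eq]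
  have hxp : x p ≠ 0 := by omega
  -- the goal, additively: `∃ r, x_r < y_r ∧ ∃ m ∈ S, x - e_p + e_r + e_m ∈ J`
  by_cases hA : x + Finsupp.single k 1 ∈ J
  · -- Case A: exchange between `x + e_k` and `y + e_k` at `p`
    have hp' : (y + Finsupp.single k 1 : σ →₀ ℕ) p < (x + Finsupp.single k 1 : σ →₀ ℕ) p := by
      simp only [Finsupp.add_apply]; omega
    obtain ⟨r, hr, hmem⟩ := hJ hA hβ p hp'
    refine ⟨r, by simpa only [Finsupp.add_apply, add_lt_add_iff_right] using hr, k, hkS, ?_⟩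
    rwa [exchange_add_right_comm hxp r k] at hmem
  · -- Case B: `x + e_k ∉ J`, so `i ≠ k`
    have hik : i ≠ k := by rintro rfl; exact hA hα
    -- Step 1: `μ := x - e_p + e_i + e_k ∈ J`, or an answer
    have step1 : (∃ r, x r < y r ∧ ∃ m ∈ S, x - Finsupp.single p 1 + Finsupp.single r 1 + Finsupp.single m 1 ∈ J) ∨
        x - Finsupp.single p 1 + Finsupp.single i 1 + Finsupp.single k 1 ∈ J := by
      by_cases h1 : (y + Finsupp.single k 1 : σ →₀ ℕ) p < (x + Finsupp.single i 1 : σ →₀ ℕ) p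
      · obtain ⟨r, hr, hmem⟩ := hJ hα hβ p h1
        rw [exchange_add_right_comm hxp r i] at hmem
        rw [Finsupp.add_apply, Finsupp.add_apply] at hr
        rcases eq_or_ne r k with hrk | hrk
        · rw [hrk, Finsupp.single_eq_same, Finsupp.single_eq_of_ne hik.symm] at hr
          rw [hrk] at hmem
          by_cases hlt : x k < y k
          · exact Or.inl ⟨k, hlt, i, hiS, hmem⟩
          · right; rwa [add_right_comm] at hmem
        · rw [Finsupp.single_eq_of_ne hrk] at hr
          exact Or.inl ⟨r, by omega, i, hiS, hmem⟩
      · -- `p = k` and `x_p = y_p + 1`: `μ = x + e_i`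
        right
        have hpk : k = p := by
          by_contra hpk
          rw [Finsupp.add_apply, Finsupp.add_apply, Finsupp.single_eq_of_ne (Ne.symm hpk)] at h1
          omega
        rw [hpk, add_right_comm, Finsupp.sub_add_single_one_cancel hxp]
        exact hα
    rcases step1 with hdone | hμ
    · exact hdone
    -- Step 2: exchange between `μ` and `y + e_k` at `i`, unless `i` itself answers
    by_cases h2 : p ≠ i ∧ x i < y i
    · exact ⟨i, h2.2, k, hkS, hμ⟩
    · have hμi : (y + Finsupp.single k 1 : σ →₀ ℕ) i <
          (x - Finsupp.single p 1 + Finsupp.single i 1 + Finsupp.single k 1 : σ →₀ ℕ) i := by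
        rw [Finsupp.add_apply, Finsupp.add_apply, Finsupp.add_apply, Finsupp.tsub_apply, Finsupp.single_eq_same,
          Finsupp.single_eq_of_ne hik]
        rcases eq_or_ne p i with hpi | hpi
        · rw [hpi] at hp hxp
          rw [hpi, Finsupp.single_eq_same]
          omega
        · rw [Finsupp.single_eq_of_ne (Ne.symm hpi)]
          rw [not_and_or, not_lt] at h2
          rcases h2 with h2 | h2
          · exact absurd hpi h2
          · omega
      obtain ⟨r, hr, hmem⟩ := hJ hμ hβ i hμi
      have hri : r ≠ i := by rintro rfl; exact lt_irrefl _ (hr.trans hμi)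
      -- `μ - e_i + e_r = x - e_p + e_r + e_k`
      have e1 : x - Finsupp.single p 1 + Finsupp.single i 1 + Finsupp.single k 1 - Finsupp.single i 1 +
          Finsupp.single r 1 = x - Finsupp.single p 1 + Finsupp.single r 1 + Finsupp.single k 1 := by
        rw [add_right_comm (x - Finsupp.single p 1), add_tsub_cancel_right, add_right_comm]
      rw [e1] at hmem
      rw [Finsupp.add_apply, Finsupp.add_apply, Finsupp.add_apply, Finsupp.tsub_apply,
        Finsupp.single_eq_of_ne hri] at hr
      by_cases hrp : r = p
      · -- `μ - e_i + e_p = x + e_k ∈ J`: excluded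
        rw [hrp, Finsupp.sub_add_single_one_cancel hxp] at hmem
        exact absurd hmem hA
      · rw [Finsupp.single_eq_of_ne hrp] at hr
        exact ⟨r, by omega, k, hkS, hmem⟩

end LowerShifts

end Literature.Combinatorics.LorentzianPolynomials

end
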